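import Summits.Ventures.PackingBounds.Energy.TenPointPetQ1GramDataA2
import Summits.Ventures.PackingBounds.Energy.TenPointPetQ1XDataC
import Summits.Ventures.PackingBounds.Energy.GramCongrCheck
import HarnessLib

/-!
# The congruence `X = P (S·Y) Pᵀ` of `e3pt-sharp-n4N10petq1d6-none.json` holds (kernel evaluation on integer data)

Framing: lottery ticket; floor = certified bounds/negative ranges. Venture `PackingBounds`, cell
`pub-packcert`, energy family E3PT (pub-packcert-energy gen 14; n = 4 kernel route = KERNEL-D6 data route + `threePointF 4`).

`decide +kernel` checks, in row chunks, `xPQ1_{ab} = Σ_i Σ_j bPQ1_{ai} yPQ1_{ij} bPQ1_{bj}` (`GramData.checkCongr`, zero entries of `bPQ1`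
skipped); `congrPQ1_all` collects the chunks for `GramData.listQuad_nonneg_of_congr` (used in `TenPointPetQ1SOS`).
-/

namespace Summit.Ventures.PackingBounds.Energy.PetQ1D6

open Summit.Ventures.PackingBounds.Energy.GramData

set_option maxRecDepth 100000 in
/-- Rows 0–20 of `X = P (S·Y) Pᵀ` (kernel evaluation). -/
theorem congrPQ1_0_21 : checkCongr 84 0 21 bPQ1 yPQ1 xPQ1 = true := by decide +kernel

set_option maxRecDepth 100000 in
/-- Rows 21–41 of `X = P (S·Y) Pᵀ` (kernel evaluation). -/
theorem congrPQ1_21_42 : checkCongr 84 21 42 bPQ1 yPQ1 xPQ1 = true := by decide +kernel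

set_option maxRecDepth 100000 in
/-- Rows 42–62 of `X = P (S·Y) Pᵀ` (kernel evaluation). -/
theorem congrPQ1_42_63 : checkCongr 84 42 63 bPQ1 yPQ1 xPQ1 = true := by decide +kernel

set_option maxRecDepth 100000 in
/-- Rows 63–83 of `X = P (S·Y) Pᵀ` (kernel evaluation). -/
theorem congrPQ1_63_84 : checkCongr 84 63 84 bPQ1 yPQ1 xPQ1 = true := by decide +kernel

/-- All entries: `X_ab = Σ_i Σ_j P_ai (S·Y)_ij P_bj` for `a, b < 84` (in the checker's recursive form). -/
theorem congrPQ1_all : ∀ a b, a < 84 → b < 84 →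
    ent xPQ1 a b = cgOuter yPQ1 (bPQ1.getD b []) (bPQ1.getD a []) 0 := by
  intro a b ha hb
  by_cases h0 : a < 21
  · exact of_checkCongr congrPQ1_0_21 a b (Nat.zero_le _) h0 hb
  by_cases h1 : a < 42
  · exact of_checkCongr congrPQ1_21_42 a b (by omega) h1 hb
  by_cases h2 : a < 63
  · exact of_checkCongr congrPQ1_42_63 a b (by omega) h2 hb
  · exact of_checkCongr congrPQ1_63_84 a b (by omega) ha hb

end Summit.Ventures.PackingBounds.Energy.PetQ1D6
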